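import Mathlib

/-!
# `BalabanUV.Beta.GAN24.CrossedLedgerUnrolled` — binder row G-an2-4 ∕ (CONV-C), W-slot (α-0), ROW (C)sym AT LEVELS `≥ 1`, register PART VI row **T6-VAL**
# (sub-row «T6-VAL∕ledger-unrolled»): **THE CROSSED-VALUE LEDGER OF THE TWO-INDEX TOWER, UNROLLED** — the general (level-DEPENDENT) ledger in closed form, its
# anti-diagonal form at road-P2's pin coefficients, and the crossed conservation `hX` as ONE explicit scalar identity per level
# (G-an2-4 CRUX TEAM (2), leaf prover 03 `b2b-balaban-gan24-formalise-leaf-03`, gen 71; journal [LEAF03-G71-INTENT1])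

NOT IN PRINT; OUR BOOKKEEPING ([folklore] `Finset.sum_range_succ` ∕ `Finset.prod_range_succ'` ∕ `Finset.sum_range_reflect` algebra on real scalars; 0 `def`, 0 cited
fact, 0 `def … : Prop`, 0 sorry; Mathlib-only imports).  HONEST FRAMING (cell contract, verbatim): «discharging `BetaPertH` makes Bałaban's UV stability UNCONDITIONAL —
a real constructive-QFT result; it is NOT the continuum limit and NOT the Clay problem.»  HONEST DEPENDENCY (verbatim): «continuum YM on T⁴ ⇐ BetaPertH ∧ nine spine
estimates (0/9 proved); BetaPertH ⇐ (D1) ∧ (D4) ∧ CAP+tail; G-an2-4 gates asym, D1 and NE2/3/4.»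

WHY.  The OWNER's junction `PairFormPeriodTower` §3 (✓ p378210) types the crossed-VALUE ledger of the two-index tower `(m, i)` = (face-period index, level) as scalars:
one step `crossed_of_step`, the located SUFFICIENT condition `crossed_tower₂_const` (level-independent word values `p m` and coefficients `c m` with ONE base identity per
period), and the guess-and-verify uniqueness `crossed_tower₂_eq_of_candidate` for the realistic level-dependent case («leaf-04's j167436 numbers have the contact and
exchange words scaling DIFFERENTLY between levels»).  RULING R-gan24p1-g40-1 (R4): «the general ledger (level-dependent values) is the unrolled sum … and its conservation in
`i` — bookkeeping».  This file IS that bookkeeping, typed before any value is known, because after road-P2 g50's rows (journal [GAN24P2-G50-INTENT1..4]) the recursion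
`X m (i+1) = p m i + c m i · X (m+1) i` holds UNCONDITIONALLY for `X m i :=` the crossed orbit sum `(a,b;a,b)` of the leg-and-bond symmetrised read `LS(Z m i)` of the
level-`i` member and `p m i :=` the same orbit sum of the E-frame FORCING's read (`faceReadSym_member_succ_pin` ∕ `legBondSym_zmode_succ_eq_dress_pin` are TABLE identities,
`LS` and the orbit sum are linear) — so the binder `hX` ∕ `hXu` ∕ `hSrcX` (crossed conservation along the level at period index `0`) is EXACTLY the scalar identity of §3
among the forcing's crossed orbit sums on two consecutive anti-diagonals `m + i = l`, `m + i = l + 1` and two base values `w (l+1)`, `w (l+2)` (closed forms ✓ in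
`PairFormPeriodTowerBase`), with NO pair-form hypothesis in between: row T6-VAL does not wait on row T6-STEP's supplier statements.
* §1 **`crossed_tower₂_unrolled`** — level-DEPENDENT `p m i`, `c m i`: `X m n = Σ_{k<n} (Π_{a<n−1−k} c (m+a) (n−1−a))·p (m+n−1−k) k + (Π_{a<n} c (m+a) (n−1−a))·w (m+n)`
  (THE candidate of `crossed_tower₂_eq_of_candidate`, by the same induction on the level with the period generalised); **`crossed_tower₂_unrolled_levelFree`** — coefficients
  `c m i = γ m` not depending on the level: the weights are the plain products `Π_{a<n−1−k} γ (m+a)`.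
* §2 **AT ROAD-P2's PIN COEFFICIENTS** (`c 0 i = γ`, `c (m+1) i = 1` — `CombChargeTowerStepZero.towerStepZero_pin_of_forcingPairForm` ∕ `CombChargeTowerStepDeepPin.
  transportCoeff_eq_one_of_pin`, any normalisation `γ` of the period-index-`0` row): **`crossed_deep_unrolled`** `X (m+1) n = Σ_{k<n} p (m+n−k) k + w (m+1+n)` and
  **`crossed_top_unrolled`** `X 0 (n+1) = p 0 n + γ·(Σ_{k<n} p (n−k) k + w (n+1))` — anti-diagonal sums, no products.
* §3 **`crossed_conserved_iff_antidiagonal`** — `(∀ l, X 0 (l+2) = X 0 (l+1)) ↔ ∀ l, p 0 (l+1) + γ·(Σ_{k≤l} p (l+1−k) k + w (l+2)) = p 0 l + γ·(Σ_{k<l} p (l−k) k + w (l+1))`;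
  **`crossed_conserved_iff_increment`** — the same as a vanishing increment; **`crossed_succ_sub_of_pin`** ∕ **`crossed_deep_succ_sub`** — the one-level increments in closed
  form at period index `0` ∕ `m+1` (what an engine tabulates level by level).
* §4 **`crossed_conserved_iff_levelFreeDeep`** — IF the deep words do not depend on the level (`p (m+1) i = q (m+1)`; the top word `p 0 i` free), the anti-diagonal
  increment collapses to ONE word: `hX ⟺ ∀ l, (p 0 (l+1) − p 0 l) + γ·(q (l+1) + (w (l+2) − w (l+1))) = 0` — level by level, the forcing's period-index-`(l+1)` crossed
  value against the base DECREMENT one period deeper (the `m ≥ 1` base identities of `crossed_tower₂_const`; its `m = 0` identity is NOT needed for conservation).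
* §5 **`crossed_conserved_iff_of_rows`** ∕ **`_pairs`** — THE ADAPTER AT TABLE LEVEL (generic index type): from the `LS`-ed top row `LS(A (i+1)) = LS(B i) + γ·LS(AF 0 i)`
  and the entrywise deep rows `AF m (i+1) = BF m i + AF (m+1) i` — the shapes of road-P2 g50's pin rows, NO pair form — the binder `hX` (one pair ∕ all distinct pairs,
  literal quantifier shape) ⟺ the §3 identity with `X`, `p`, `w` read off the rows; instantiate `A ∕ AF ∕ B ∕ BF` by the member's ∕ forcing's cell and face reads.
Levels are spelled `l + 1 + 1` as in the literal's `hX`.  Discharges NOTHING of (C)_{≥1} ∕ `hX` ∕ `hXu` ∕ `hSrc` ∕ `hSrcX` ∕ (Q-L) ∕ (H1♮) ∕ (hW, hWall); asserts NO value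
and NO shape of Bałaban's tables (every `p`, `q`, `c`, `w`, `γ` is a free real letter); NEVER «G-an2-4 closed» as (CONV-C); NOT D1, NOT `BetaPertH`, NOT continuum, NOT
Clay.  2026-08-24; no existing file touched.
-/

open Finset
open scoped BigOperators

namespace Summit.QuantumFields.BalabanUV.Beta.GAN24.CrossedLedgerUnrolled

/-! ## §1 The general ledger, unrolled (level-dependent word values and coefficients) -/

/-- NOT IN PRINT; OUR BOOKKEEPING.  **THE TWO-INDEX CROSSED LEDGER IN CLOSED FORM** (level-DEPENDENT word values `p m i` and coefficients `c m i`): if `X m 0 = w m` and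
`X m (i+1) = p m i + c m i · X (m+1) i` at every period index `m` and level `i`, then at every `(m, n)` the value is the unrolled sum along the anti-diagonal below it —
`X m n = Σ_{k<n} (Π_{a<n−1−k} c (m+a) (n−1−a)) · p (m+n−1−k) k + (Π_{a<n} c (m+a) (n−1−a)) · w (m+n)` (the word of period index `m+n−1−k` at level `k` enters with the
product of the coefficients met on the way down from `(m, n)`; the base value `w (m+n)` with the full product).  Induction on the level with the period generalised. -/
theorem crossed_tower₂_unrolled {X p c : ℕ → ℕ → ℝ} {w : ℕ → ℝ}
    (h0 : ∀ m, X m 0 = w m) (hstep : ∀ m i, X m (i + 1) = p m i + c m i * X (m + 1) i) (m n : ℕ) :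
    X m n = (∑ k ∈ range n, (∏ a ∈ range (n - 1 - k), c (m + a) (n - 1 - a)) * p (m + n - 1 - k) k)
      + (∏ a ∈ range n, c (m + a) (n - 1 - a)) * w (m + n) := by
  induction n generalizing m with
  | zero => simp [h0]
  | succ n ih =>
    rw [hstep m n, ih (m + 1), Finset.sum_range_succ, Finset.prod_range_succ']
    have hlast : (∏ a ∈ range (n + 1 - 1 - n), c (m + a) (n + 1 - 1 - a)) * p (m + (n + 1) - 1 - n) n = p m n := by
      rw [show n + 1 - 1 - n = 0 by omega, Finset.prod_range_zero, one_mul]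
      exact congrArg₂ p (by omega) rfl
    have hk : ∀ k ∈ range n, (∏ a ∈ range (n + 1 - 1 - k), c (m + a) (n + 1 - 1 - a)) * p (m + (n + 1) - 1 - k) k
        = c m n * ((∏ a ∈ range (n - 1 - k), c (m + 1 + a) (n - 1 - a)) * p (m + 1 + n - 1 - k) k) := by
      intro k hk
      have hkn : k < n := Finset.mem_range.mp hk
      rw [show n + 1 - 1 - k = (n - 1 - k) + 1 by omega, Finset.prod_range_succ']
      rw [Finset.prod_congr rfl (fun a _ =>
        (congrArg₂ c (by omega) (by omega) : c (m + (a + 1)) (n + 1 - 1 - (a + 1)) = c (m + 1 + a) (n - 1 - a)))]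
      rw [(congrArg₂ c (by omega) (by omega) : c (m + 0) (n + 1 - 1 - 0) = c m n),
        (congrArg₂ p (by omega) rfl : p (m + (n + 1) - 1 - k) k = p (m + 1 + n - 1 - k) k)]
      ring
    have hw : (∏ a ∈ range n, c (m + (a + 1)) (n + 1 - 1 - (a + 1))) * c (m + 0) (n + 1 - 1 - 0)
        = c m n * ∏ a ∈ range n, c (m + 1 + a) (n - 1 - a) := by
      rw [Finset.prod_congr rfl (fun a _ =>
        (congrArg₂ c (by omega) (by omega) : c (m + (a + 1)) (n + 1 - 1 - (a + 1)) = c (m + 1 + a) (n - 1 - a)))]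
      rw [(congrArg₂ c (by omega) (by omega) : c (m + 0) (n + 1 - 1 - 0) = c m n)]
      ring
    rw [Finset.sum_congr rfl hk, hlast, hw, ← Finset.mul_sum, show m + (n + 1) = m + 1 + n by omega]
    ring

/-- NOT IN PRINT; OUR BOOKKEEPING.  **LEVEL-INDEPENDENT COEFFICIENTS** `c m i = γ m` (the pins' case — road-P2 g50: the period-index-`0` coefficient and the transport
coefficient `c·K_j⁴` do not depend on the level at `d = 3`, `cE₂ = Lc⁸`; the word values `p m i` stay level-dependent): the weights are the plain products
`Π_{a<n−1−k} γ (m+a)`. -/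
theorem crossed_tower₂_unrolled_levelFree {X p : ℕ → ℕ → ℝ} {γ w : ℕ → ℝ}
    (h0 : ∀ m, X m 0 = w m) (hstep : ∀ m i, X m (i + 1) = p m i + γ m * X (m + 1) i) (m n : ℕ) :
    X m n = (∑ k ∈ range n, (∏ a ∈ range (n - 1 - k), γ (m + a)) * p (m + n - 1 - k) k)
      + (∏ a ∈ range n, γ (m + a)) * w (m + n) :=
  crossed_tower₂_unrolled (c := fun m _ => γ m) h0 hstep m n

/-! ## §2 At road-P2's pin coefficients: anti-diagonal sums -/

/-- NOT IN PRINT; OUR BOOKKEEPING.  **THE DEEP ROWS AT COEFFICIENT ONE** (`c (m+1) i = 1`, road-P2 g50's `transportCoeff_eq_one_of_pin`; the period-index-`0` row is not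
used): `X (m+1) n = Σ_{k<n} p (m+n−k) k + w (m+1+n)` — the crossed value of the level-`n` member read at period index `m+1` is the PLAIN SUM of the forcing's crossed
values down the anti-diagonal plus the base value at its foot. -/
theorem crossed_deep_unrolled {X p : ℕ → ℕ → ℝ} {w : ℕ → ℝ}
    (h0 : ∀ m, X m 0 = w m) (hdeep : ∀ m i, X (m + 1) (i + 1) = p (m + 1) i + X (m + 1 + 1) i) (m n : ℕ) :
    X (m + 1) n = (∑ k ∈ range n, p (m + n - k) k) + w (m + 1 + n) := by
  induction n generalizing m with
  | zero => simp [h0]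
  | succ n ih =>
    rw [hdeep m n, ih (m + 1), Finset.sum_range_succ]
    have hk : ∀ k ∈ range n, p (m + 1 + n - k) k = p (m + (n + 1) - k) k := fun k _ => congrArg₂ p (by omega) rfl
    rw [Finset.sum_congr rfl hk, show m + (n + 1) - n = m + 1 by omega, show m + 1 + 1 + n = m + 1 + (n + 1) by omega]
    ring

/-- NOT IN PRINT; OUR BOOKKEEPING.  **THE TOP ROW** (period index `0`, coefficient `γ` — road-P2 g50's `towerStepZero_pin_of_forcingPairForm` has `γ = 1` in the `𝔇`-dressed
convention and `γ = Lc⁴` in the four-face convention; kept as a letter): `X 0 (n+1) = p 0 n + γ·(Σ_{k<n} p (n−k) k + w (n+1))`. -/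
theorem crossed_top_unrolled {X p : ℕ → ℕ → ℝ} {w : ℕ → ℝ} {γ : ℝ}
    (h0 : ∀ m, X m 0 = w m) (htop : ∀ i, X 0 (i + 1) = p 0 i + γ * X 1 i)
    (hdeep : ∀ m i, X (m + 1) (i + 1) = p (m + 1) i + X (m + 1 + 1) i) (n : ℕ) :
    X 0 (n + 1) = p 0 n + γ * ((∑ k ∈ range n, p (n - k) k) + w (n + 1)) := by
  have h := crossed_deep_unrolled h0 hdeep 0 n
  rw [Nat.zero_add] at h
  have hk : ∀ k ∈ range n, p (0 + n - k) k = p (n - k) k := fun k _ => congrArg₂ p (by omega) rfl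
  rw [Finset.sum_congr rfl hk, show (1 : ℕ) + n = n + 1 by omega] at h
  rw [htop n, h]

/-! ## §3 The crossed conservation `hX` as one scalar identity per level -/

/-- NOT IN PRINT; OUR BOOKKEEPING.  **`hX` ⟺ THE ANTI-DIAGONAL IDENTITY** (road-P2's pin coefficients; NO pair form and NO value asserted): the crossed orbit sums of the
member at period index `0` are constant along the levels `≥ 1` (`∀ l, X 0 (l+1+1) = X 0 (l+1)` — the binder `hX` of `PairFormPeriodTower.zsymLegSymEven_of_tower₂_crossed` ∕
`hXu` of `PairFormSourceOfMember.sourceCrossed_of_memberCrossed`, read as scalars for one ordered pair `a ≠ b`) IF AND ONLY IF, at every level `l`, the forcing's crossed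
values on the two anti-diagonals `m + i = l + 1` and `m + i = l` and the two base values satisfy
`p 0 (l+1) + γ·(Σ_{k≤l} p (l+1−k) k + w (l+2)) = p 0 l + γ·(Σ_{k<l} p (l−k) k + w (l+1))`. -/
theorem crossed_conserved_iff_antidiagonal {X p : ℕ → ℕ → ℝ} {w : ℕ → ℝ} {γ : ℝ}
    (h0 : ∀ m, X m 0 = w m) (htop : ∀ i, X 0 (i + 1) = p 0 i + γ * X 1 i)
    (hdeep : ∀ m i, X (m + 1) (i + 1) = p (m + 1) i + X (m + 1 + 1) i) :
    (∀ l, X 0 (l + 1 + 1) = X 0 (l + 1)) ↔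
      ∀ l, p 0 (l + 1) + γ * ((∑ k ∈ range (l + 1), p (l + 1 - k) k) + w (l + 1 + 1))
        = p 0 l + γ * ((∑ k ∈ range l, p (l - k) k) + w (l + 1)) := by
  refine forall_congr' fun l => ?_
  rw [crossed_top_unrolled h0 htop hdeep (l + 1), crossed_top_unrolled h0 htop hdeep l]

/-- NOT IN PRINT; OUR BOOKKEEPING.  **THE SAME AS A VANISHING INCREMENT**: `hX` ⟺ at every level
`(p 0 (l+1) − p 0 l) + γ·((Σ_{k≤l} p (l+1−k) k − Σ_{k<l} p (l−k) k) + (w (l+2) − w (l+1))) = 0` — the top word's level increment, plus `γ` times the increment of the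
anti-diagonal sum of the deep words, plus `γ` times the base increment one period deeper. -/
theorem crossed_conserved_iff_increment {X p : ℕ → ℕ → ℝ} {w : ℕ → ℝ} {γ : ℝ}
    (h0 : ∀ m, X m 0 = w m) (htop : ∀ i, X 0 (i + 1) = p 0 i + γ * X 1 i)
    (hdeep : ∀ m i, X (m + 1) (i + 1) = p (m + 1) i + X (m + 1 + 1) i) :
    (∀ l, X 0 (l + 1 + 1) = X 0 (l + 1)) ↔
      ∀ l, (p 0 (l + 1) - p 0 l)
        + γ * (((∑ k ∈ range (l + 1), p (l + 1 - k) k) - ∑ k ∈ range l, p (l - k) k) + (w (l + 1 + 1) - w (l + 1))) = 0 := by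
  rw [crossed_conserved_iff_antidiagonal h0 htop hdeep]
  refine forall_congr' fun l => ?_
  constructor
  · intro h
    linear_combination h
  · intro h
    linear_combination h

/-- NOT IN PRINT; OUR BOOKKEEPING.  **THE ONE-LEVEL INCREMENT AT PERIOD INDEX `0` IN CLOSED FORM** (what an engine tabulates level by level; `hX` at level `l` says it is
`0`): `X 0 (l+2) − X 0 (l+1) = (p 0 (l+1) − p 0 l) + γ·((Σ_{k≤l} p (l+1−k) k − Σ_{k<l} p (l−k) k) + (w (l+2) − w (l+1)))`. -/
theorem crossed_succ_sub_of_pin {X p : ℕ → ℕ → ℝ} {w : ℕ → ℝ} {γ : ℝ}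
    (h0 : ∀ m, X m 0 = w m) (htop : ∀ i, X 0 (i + 1) = p 0 i + γ * X 1 i)
    (hdeep : ∀ m i, X (m + 1) (i + 1) = p (m + 1) i + X (m + 1 + 1) i) (l : ℕ) :
    X 0 (l + 1 + 1) - X 0 (l + 1) = (p 0 (l + 1) - p 0 l)
      + γ * (((∑ k ∈ range (l + 1), p (l + 1 - k) k) - ∑ k ∈ range l, p (l - k) k) + (w (l + 1 + 1) - w (l + 1))) := by
  rw [crossed_top_unrolled h0 htop hdeep (l + 1), crossed_top_unrolled h0 htop hdeep l]
  ring

/-- NOT IN PRINT; OUR BOOKKEEPING.  **THE DEEP ROWS' ONE-LEVEL INCREMENT** (period index `m+1`, coefficient one; recorded for the suppliers who state their words at a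
general period): `X (m+1) (n+1) − X (m+1) n = (Σ_{k≤n} p (m+n+1−k) k − Σ_{k<n} p (m+n−k) k) + (w (m+n+2) − w (m+n+1))`. -/
theorem crossed_deep_succ_sub {X p : ℕ → ℕ → ℝ} {w : ℕ → ℝ}
    (h0 : ∀ m, X m 0 = w m) (hdeep : ∀ m i, X (m + 1) (i + 1) = p (m + 1) i + X (m + 1 + 1) i) (m n : ℕ) :
    X (m + 1) (n + 1) - X (m + 1) n
      = ((∑ k ∈ range (n + 1), p (m + n + 1 - k) k) - ∑ k ∈ range n, p (m + n - k) k) + (w (m + n + 1 + 1) - w (m + n + 1)) := by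
  rw [crossed_deep_unrolled h0 hdeep m (n + 1), crossed_deep_unrolled h0 hdeep m n,
    show m + (n + 1) = m + n + 1 by omega, show m + 1 + (n + 1) = m + n + 1 + 1 by omega, show m + 1 + n = m + n + 1 by omega]
  ring

/-! ## §4 Level-independent deep words: the increment collapses to one word per level -/

/-- NOT IN PRINT; OUR BOOKKEEPING.  **THE ANTI-DIAGONAL INCREMENT OF LEVEL-FREE DEEP WORDS IS ONE WORD**: if `p (m+1) i = q (m+1)` for every level `i`, then
`Σ_{k≤l} p (l+1−k) k − Σ_{k<l} p (l−k) k = q (l+1)` (`Finset.sum_range_reflect` twice + `Finset.sum_range_succ`). -/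
theorem antidiagonal_increment_of_levelFree {p : ℕ → ℕ → ℝ} {q : ℕ → ℝ} (hq : ∀ m i, p (m + 1) i = q (m + 1)) (l : ℕ) :
    (∑ k ∈ range (l + 1), p (l + 1 - k) k) - ∑ k ∈ range l, p (l - k) k = q (l + 1) := by
  have hA : ∑ k ∈ range (l + 1), p (l + 1 - k) k = ∑ k ∈ range (l + 1), q (k + 1) := by
    rw [← Finset.sum_range_reflect (fun k => q (k + 1)) (l + 1)]
    refine Finset.sum_congr rfl fun k hk => ?_
    have hkl : k < l + 1 := Finset.mem_range.mp hk
    rw [show l + 1 - k = l - k + 1 by omega, hq]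
    exact congrArg q (by omega)
  have hB : ∑ k ∈ range l, p (l - k) k = ∑ k ∈ range l, q (k + 1) := by
    rw [← Finset.sum_range_reflect (fun k => q (k + 1)) l]
    refine Finset.sum_congr rfl fun k hk => ?_
    have hkl : k < l := Finset.mem_range.mp hk
    rw [show l - k = l - 1 - k + 1 by omega, hq]
  rw [hA, hB, Finset.sum_range_succ]
  ring

/-- NOT IN PRINT; OUR BOOKKEEPING.  **`hX` WITH LEVEL-FREE DEEP WORDS** (road-P2's pin coefficients; the top word `p 0 i` may depend on the level): if the forcing's deep
crossed values do not depend on the level, `p (m+1) i = q (m+1)`, then the crossed conservation holds IFF at every level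
`(p 0 (l+1) − p 0 l) + γ·(q (l+1) + (w (l+2) − w (l+1))) = 0` — the period-index-`(l+1)` word against the base DECREMENT one period deeper (for a level-free top word and
`γ ≠ 0`: `q (l+1) = w (l+1) − w (l+2)`, the `m ≥ 1` base identities of `PairFormPeriodTower.crossed_tower₂_const` with `c = 1`; its `m = 0` identity is not needed). -/
theorem crossed_conserved_iff_levelFreeDeep {X p : ℕ → ℕ → ℝ} {q w : ℕ → ℝ} {γ : ℝ}
    (h0 : ∀ m, X m 0 = w m) (htop : ∀ i, X 0 (i + 1) = p 0 i + γ * X 1 i)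
    (hdeep : ∀ m i, X (m + 1) (i + 1) = p (m + 1) i + X (m + 1 + 1) i) (hq : ∀ m i, p (m + 1) i = q (m + 1)) :
    (∀ l, X 0 (l + 1 + 1) = X 0 (l + 1)) ↔
      ∀ l, (p 0 (l + 1) - p 0 l) + γ * (q (l + 1) + (w (l + 1 + 1) - w (l + 1))) = 0 := by
  rw [crossed_conserved_iff_increment h0 htop hdeep]
  refine forall_congr' fun l => ?_
  rw [antidiagonal_increment_of_levelFree hq l]

/-- NOT IN PRINT; OUR BOOKKEEPING.  **HENCE, WITH A LEVEL-FREE TOP WORD TOO** (`p 0 i = q 0`) **AND `γ ≠ 0`**: `hX ⟺ ∀ l, q (l+1) = w (l+1) − w (l+2)` — the deep words ARE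
the base decrements; nothing is asked of `q 0`. -/
theorem crossed_conserved_iff_levelFree {X p : ℕ → ℕ → ℝ} {q w : ℕ → ℝ} {γ : ℝ} (hγ : γ ≠ 0)
    (h0 : ∀ m, X m 0 = w m) (htop : ∀ i, X 0 (i + 1) = p 0 i + γ * X 1 i)
    (hdeep : ∀ m i, X (m + 1) (i + 1) = p (m + 1) i + X (m + 1 + 1) i) (hq : ∀ m i, p m i = q m) :
    (∀ l, X 0 (l + 1 + 1) = X 0 (l + 1)) ↔ ∀ l, q (l + 1) = w (l + 1) - w (l + 1 + 1) := by
  rw [crossed_conserved_iff_levelFreeDeep h0 htop hdeep (fun m i => hq (m + 1) i)]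
  refine forall_congr' fun l => ?_
  rw [hq 0 (l + 1), hq 0 l, sub_self, zero_add]
  constructor
  · intro h
    have h' : q (l + 1) + (w (l + 1 + 1) - w (l + 1)) = 0 := (mul_eq_zero.mp h).resolve_left hγ
    linear_combination h'
  · intro h
    rw [h]
    ring

/-! ## §5 At table level: the rows as road-P2 states them ⟹ `hX` is the scalar identity (the adapter to instantiate) -/

/-- NOT IN PRINT; OUR BOOKKEEPING.  **THE ADAPTER AT TABLE LEVEL** (generic index type; the shape in which road-P2 g50's pin rows are stated, NO pair form anywhere):
let `A i` be the level-`i` member's cell read (`κ κ′ κ₁ κ₂ ↦ zmode Lc (unitS₂_i T̃_i) κ κ′ (inl κ₁) (inl κ₂)`), `AF m i` its bond-symmetrised face read at the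
period `P m` (`FFsym_(P m)(unitS₂_i T̃_i)`), `B i` ∕ `BF m i` the same two reads of the E-frame FORCING `b̃_i`; suppose the `LS`-ed top row
`LS(A (i+1)) = LS(B i) + γ·LS(AF 0 i)` (`CombChargeTowerStepZero` at the pins, any normalisation `γ`) and the ENTRYWISE deep rows `AF m (i+1) = BF m i + AF (m+1) i`
(`CombChargeTowerStepDeepPin.faceReadSym_member_succ_pin`, `P (m+1) = Lc·P m`).  Then for every ordered pair `(a, b)` the crossed-orbit conservation of the member's
symmetrised cell charge along the levels `≥ 1` — the binder `hX` of `PairFormPeriodTower.zsymLegSymEven_of_tower₂_crossed` at that pair, VERBATIM shape — holds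
IF AND ONLY IF at every level `l` the forcing's crossed orbit sums on the anti-diagonals `m + i = l + 1`, `m + i = l` and the level-`0` face reads at the periods
`P (l+1)`, `P l` satisfy the explicit identity of §3 (`crossed_conserved_iff_increment` with `X`, `p`, `w` read off the rows by `Nat.rec` on the period index). -/
theorem crossed_conserved_iff_of_rows {ι : Type*} {A B : ℕ → ι → ι → ι → ι → ℝ} {AF BF : ℕ → ℕ → ι → ι → ι → ι → ℝ} {γ : ℝ}
    (htop : ∀ (i : ℕ) (κ κ' κ₁ κ₂ : ι),
      A (i + 1) κ κ' κ₁ κ₂ + A (i + 1) κ' κ κ₁ κ₂ + (A (i + 1) κ κ' κ₂ κ₁ + A (i + 1) κ' κ κ₂ κ₁)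
        = B i κ κ' κ₁ κ₂ + B i κ' κ κ₁ κ₂ + (B i κ κ' κ₂ κ₁ + B i κ' κ κ₂ κ₁)
          + γ * (AF 0 i κ κ' κ₁ κ₂ + AF 0 i κ' κ κ₁ κ₂ + (AF 0 i κ κ' κ₂ κ₁ + AF 0 i κ' κ κ₂ κ₁)))
    (hdeep : ∀ (m i : ℕ) (κ κ' κ₁ κ₂ : ι), AF m (i + 1) κ κ' κ₁ κ₂ = BF m i κ κ' κ₁ κ₂ + AF (m + 1) i κ κ' κ₁ κ₂)
    (a b : ι) :
    (∀ l : ℕ, A (l + 1 + 1) a b a b + A (l + 1 + 1) b a a b + (A (l + 1 + 1) a b b a + A (l + 1 + 1) b a b a)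
        = A (l + 1) a b a b + A (l + 1) b a a b + (A (l + 1) a b b a + A (l + 1) b a b a)) ↔
      ∀ l : ℕ, ((B (l + 1) a b a b + B (l + 1) b a a b + (B (l + 1) a b b a + B (l + 1) b a b a))
          - (B l a b a b + B l b a a b + (B l a b b a + B l b a b a)))
        + γ * (((∑ k ∈ range (l + 1), (BF (l - k) k a b a b + BF (l - k) k b a a b + (BF (l - k) k a b b a + BF (l - k) k b a b a)))
              - ∑ k ∈ range l, (BF (l - 1 - k) k a b a b + BF (l - 1 - k) k b a a b + (BF (l - 1 - k) k a b b a + BF (l - 1 - k) k b a b a)))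
            + ((AF (l + 1) 0 a b a b + AF (l + 1) 0 b a a b + (AF (l + 1) 0 a b b a + AF (l + 1) 0 b a b a))
              - (AF l 0 a b a b + AF l 0 b a a b + (AF l 0 a b b a + AF l 0 b a b a)))) = 0 := by
  have key := crossed_conserved_iff_increment (γ := γ)
    (X := fun m i => Nat.rec (motive := fun _ => ℝ) (A i a b a b + A i b a a b + (A i a b b a + A i b a b a))
      (fun m' _ => AF m' i a b a b + AF m' i b a a b + (AF m' i a b b a + AF m' i b a b a)) m)
    (p := fun m i => Nat.rec (motive := fun _ => ℝ) (B i a b a b + B i b a a b + (B i a b b a + B i b a b a))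
      (fun m' _ => BF m' i a b a b + BF m' i b a a b + (BF m' i a b b a + BF m' i b a b a)) m)
    (w := fun m => Nat.rec (motive := fun _ => ℝ) (A 0 a b a b + A 0 b a a b + (A 0 a b b a + A 0 b a b a))
      (fun m' _ => AF m' 0 a b a b + AF m' 0 b a a b + (AF m' 0 a b b a + AF m' 0 b a b a)) m)
    (fun m => by cases m <;> rfl) (fun i => htop i a b a b)
    (fun m i => by
      show AF m (i + 1) a b a b + AF m (i + 1) b a a b + (AF m (i + 1) a b b a + AF m (i + 1) b a b a)
        = (BF m i a b a b + BF m i b a a b + (BF m i a b b a + BF m i b a b a))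
          + (AF (m + 1) i a b a b + AF (m + 1) i b a a b + (AF (m + 1) i a b b a + AF (m + 1) i b a b a))
      rw [hdeep m i a b a b, hdeep m i b a a b, hdeep m i a b b a, hdeep m i b a b a]
      ring)
  refine key.trans (forall_congr' fun l => Eq.congr_left ?_)
  show ((B (l + 1) a b a b + B (l + 1) b a a b + (B (l + 1) a b b a + B (l + 1) b a b a))
          - (B l a b a b + B l b a a b + (B l a b b a + B l b a b a)))
        + γ * (((∑ k ∈ range (l + 1), Nat.rec (motive := fun _ => ℝ) (B k a b a b + B k b a a b + (B k a b b a + B k b a b a))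
                  (fun m' _ => BF m' k a b a b + BF m' k b a a b + (BF m' k a b b a + BF m' k b a b a)) (l + 1 - k))
              - ∑ k ∈ range l, Nat.rec (motive := fun _ => ℝ) (B k a b a b + B k b a a b + (B k a b b a + B k b a b a))
                  (fun m' _ => BF m' k a b a b + BF m' k b a a b + (BF m' k a b b a + BF m' k b a b a)) (l - k))
            + ((AF (l + 1) 0 a b a b + AF (l + 1) 0 b a a b + (AF (l + 1) 0 a b b a + AF (l + 1) 0 b a b a))
              - (AF l 0 a b a b + AF l 0 b a a b + (AF l 0 a b b a + AF l 0 b a b a)))) = _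
  have hS1 : ∀ k ∈ range (l + 1), (Nat.rec (motive := fun _ => ℝ) (B k a b a b + B k b a a b + (B k a b b a + B k b a b a))
        (fun m' _ => BF m' k a b a b + BF m' k b a a b + (BF m' k a b b a + BF m' k b a b a)) (l + 1 - k) : ℝ)
      = BF (l - k) k a b a b + BF (l - k) k b a a b + (BF (l - k) k a b b a + BF (l - k) k b a b a) := by
    intro k hk
    have hkl : k < l + 1 := Finset.mem_range.mp hk
    rw [show l + 1 - k = l - k + 1 by omega]
  have hS2 : ∀ k ∈ range l, (Nat.rec (motive := fun _ => ℝ) (B k a b a b + B k b a a b + (B k a b b a + B k b a b a))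
        (fun m' _ => BF m' k a b a b + BF m' k b a a b + (BF m' k a b b a + BF m' k b a b a)) (l - k) : ℝ)
      = BF (l - 1 - k) k a b a b + BF (l - 1 - k) k b a a b + (BF (l - 1 - k) k a b b a + BF (l - 1 - k) k b a b a) := by
    intro k hk
    have hkl : k < l := Finset.mem_range.mp hk
    rw [show l - k = l - 1 - k + 1 by omega]
  rw [Finset.sum_congr rfl hS1, Finset.sum_congr rfl hS2]

/-- NOT IN PRINT; OUR BOOKKEEPING.  **THE SAME OVER ALL ORDERED DISTINCT PAIRS** — the binder `hX : ∀ l a b, a ≠ b → …` of `zsymLegSymEven_of_tower₂_crossed` ∕ F9 §3 in its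
literal quantifier shape ⟺ the §3 identity for every distinct pair and level. -/
theorem crossed_conserved_iff_of_rows_pairs {ι : Type*} {A B : ℕ → ι → ι → ι → ι → ℝ} {AF BF : ℕ → ℕ → ι → ι → ι → ι → ℝ} {γ : ℝ}
    (htop : ∀ (i : ℕ) (κ κ' κ₁ κ₂ : ι),
      A (i + 1) κ κ' κ₁ κ₂ + A (i + 1) κ' κ κ₁ κ₂ + (A (i + 1) κ κ' κ₂ κ₁ + A (i + 1) κ' κ κ₂ κ₁)
        = B i κ κ' κ₁ κ₂ + B i κ' κ κ₁ κ₂ + (B i κ κ' κ₂ κ₁ + B i κ' κ κ₂ κ₁)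
          + γ * (AF 0 i κ κ' κ₁ κ₂ + AF 0 i κ' κ κ₁ κ₂ + (AF 0 i κ κ' κ₂ κ₁ + AF 0 i κ' κ κ₂ κ₁)))
    (hdeep : ∀ (m i : ℕ) (κ κ' κ₁ κ₂ : ι), AF m (i + 1) κ κ' κ₁ κ₂ = BF m i κ κ' κ₁ κ₂ + AF (m + 1) i κ κ' κ₁ κ₂) :
    (∀ (l : ℕ) (a b : ι), a ≠ b → A (l + 1 + 1) a b a b + A (l + 1 + 1) b a a b + (A (l + 1 + 1) a b b a + A (l + 1 + 1) b a b a)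
        = A (l + 1) a b a b + A (l + 1) b a a b + (A (l + 1) a b b a + A (l + 1) b a b a)) ↔
      ∀ (a b : ι), a ≠ b → ∀ l : ℕ, ((B (l + 1) a b a b + B (l + 1) b a a b + (B (l + 1) a b b a + B (l + 1) b a b a))
          - (B l a b a b + B l b a a b + (B l a b b a + B l b a b a)))
        + γ * (((∑ k ∈ range (l + 1), (BF (l - k) k a b a b + BF (l - k) k b a a b + (BF (l - k) k a b b a + BF (l - k) k b a b a)))
              - ∑ k ∈ range l, (BF (l - 1 - k) k a b a b + BF (l - 1 - k) k b a a b + (BF (l - 1 - k) k a b b a + BF (l - 1 - k) k b a b a)))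
            + ((AF (l + 1) 0 a b a b + AF (l + 1) 0 b a a b + (AF (l + 1) 0 a b b a + AF (l + 1) 0 b a b a))
              - (AF l 0 a b a b + AF l 0 b a a b + (AF l 0 a b b a + AF l 0 b a b a)))) = 0 := by
  constructor
  · intro h a b hab
    exact (crossed_conserved_iff_of_rows htop hdeep a b).1 (fun l => h l a b hab)
  · intro h l a b hab
    exact (crossed_conserved_iff_of_rows htop hdeep a b).2 (h a b hab) l

/-! ## §6 The RATIO form (a charge factor `u ≠ 1`: generic `cE₂`, or `d ≠ 3` at the pins where `u = Lc^(d−3)`)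

v2 (2026-08-24, leaf-03 g71; APPEND-ONLY — §1–§5 above are the landed v1.1 bytes f64abd6287277d22, p380360 ✓ ced94f6b27da, untouched): the ledger's conservation
statements of §3 ∕ §5 with a charge factor `u` kept on the right, for `PairFormSourceOfMember.sourceCrossed_of_memberCrossed`'s `hXu` when `u` is not rewritten to `1`
(generic `cE₂`; or road-P2's generic-`d` rows at the pins, where the deep coefficient is still `1` but `u = 2λ̂ = Lc^(d−3)`). -/

/-- NOT IN PRINT; OUR BOOKKEEPING.  **THE CROSSED RATIO AS ONE SCALAR IDENTITY PER LEVEL** (road-P2's pin coefficients on the deep rows, any top coefficient `γ`, any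
charge factor `u`): `(∀ l, X 0 (l+1+1) = u·X 0 (l+1)) ↔ ∀ l, p 0 (l+1) + γ·(Σ_{k<l+1} p (l+1−k) k + w (l+1+1)) = u·(p 0 l + γ·(Σ_{k<l} p (l−k) k + w (l+1)))` — the shape of
`PairFormSourceOfMember.sourceCrossed_of_memberCrossed`'s `hXu` when `u` is not rewritten to `1` (generic `cE₂`; or the pins at `d ≠ 3`). -/
theorem crossed_ratio_iff_antidiagonal {X p : ℕ → ℕ → ℝ} {w : ℕ → ℝ} {γ u : ℝ}
    (h0 : ∀ m, X m 0 = w m) (htop : ∀ i, X 0 (i + 1) = p 0 i + γ * X 1 i)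
    (hdeep : ∀ m i, X (m + 1) (i + 1) = p (m + 1) i + X (m + 1 + 1) i) :
    (∀ l, X 0 (l + 1 + 1) = u * X 0 (l + 1)) ↔
      ∀ l, p 0 (l + 1) + γ * ((∑ k ∈ range (l + 1), p (l + 1 - k) k) + w (l + 1 + 1))
        = u * (p 0 l + γ * ((∑ k ∈ range l, p (l - k) k) + w (l + 1))) := by
  refine forall_congr' fun l => ?_
  rw [crossed_top_unrolled h0 htop hdeep (l + 1), crossed_top_unrolled h0 htop hdeep l]

/-- NOT IN PRINT; OUR BOOKKEEPING.  **THE RATIO ADAPTER AT TABLE LEVEL** (§5's letters; any `γ`, `u`): from the `LS`-ed top row and the entrywise deep rows, for every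
ordered pair `(a, b)`: `(∀ l, LS(A (l+1+1))(a,b;a,b) = u·LS(A (l+1))(a,b;a,b)) ↔` the explicit identity with the forcing's crossed orbit sums and the level-`0` face reads,
`u` kept on the right. -/
theorem crossed_ratio_iff_of_rows {ι : Type*} {A B : ℕ → ι → ι → ι → ι → ℝ} {AF BF : ℕ → ℕ → ι → ι → ι → ι → ℝ} {γ u : ℝ}
    (htop : ∀ (i : ℕ) (κ κ' κ₁ κ₂ : ι),
      A (i + 1) κ κ' κ₁ κ₂ + A (i + 1) κ' κ κ₁ κ₂ + (A (i + 1) κ κ' κ₂ κ₁ + A (i + 1) κ' κ κ₂ κ₁)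
        = B i κ κ' κ₁ κ₂ + B i κ' κ κ₁ κ₂ + (B i κ κ' κ₂ κ₁ + B i κ' κ κ₂ κ₁)
          + γ * (AF 0 i κ κ' κ₁ κ₂ + AF 0 i κ' κ κ₁ κ₂ + (AF 0 i κ κ' κ₂ κ₁ + AF 0 i κ' κ κ₂ κ₁)))
    (hdeep : ∀ (m i : ℕ) (κ κ' κ₁ κ₂ : ι), AF m (i + 1) κ κ' κ₁ κ₂ = BF m i κ κ' κ₁ κ₂ + AF (m + 1) i κ κ' κ₁ κ₂)
    (a b : ι) :
    (∀ l : ℕ, A (l + 1 + 1) a b a b + A (l + 1 + 1) b a a b + (A (l + 1 + 1) a b b a + A (l + 1 + 1) b a b a)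
        = u * (A (l + 1) a b a b + A (l + 1) b a a b + (A (l + 1) a b b a + A (l + 1) b a b a))) ↔
      ∀ l : ℕ, (B (l + 1) a b a b + B (l + 1) b a a b + (B (l + 1) a b b a + B (l + 1) b a b a))
          + γ * ((∑ k ∈ range (l + 1), (BF (l - k) k a b a b + BF (l - k) k b a a b + (BF (l - k) k a b b a + BF (l - k) k b a b a)))
            + (AF (l + 1) 0 a b a b + AF (l + 1) 0 b a a b + (AF (l + 1) 0 a b b a + AF (l + 1) 0 b a b a)))
        = u * ((B l a b a b + B l b a a b + (B l a b b a + B l b a b a))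
          + γ * ((∑ k ∈ range l, (BF (l - 1 - k) k a b a b + BF (l - 1 - k) k b a a b + (BF (l - 1 - k) k a b b a + BF (l - 1 - k) k b a b a)))
            + (AF l 0 a b a b + AF l 0 b a a b + (AF l 0 a b b a + AF l 0 b a b a)))) := by
  have key := crossed_ratio_iff_antidiagonal (γ := γ) (u := u)
    (X := fun m i => Nat.rec (motive := fun _ => ℝ) (A i a b a b + A i b a a b + (A i a b b a + A i b a b a))
      (fun m' _ => AF m' i a b a b + AF m' i b a a b + (AF m' i a b b a + AF m' i b a b a)) m)
    (p := fun m i => Nat.rec (motive := fun _ => ℝ) (B i a b a b + B i b a a b + (B i a b b a + B i b a b a))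
      (fun m' _ => BF m' i a b a b + BF m' i b a a b + (BF m' i a b b a + BF m' i b a b a)) m)
    (w := fun m => Nat.rec (motive := fun _ => ℝ) (A 0 a b a b + A 0 b a a b + (A 0 a b b a + A 0 b a b a))
      (fun m' _ => AF m' 0 a b a b + AF m' 0 b a a b + (AF m' 0 a b b a + AF m' 0 b a b a)) m)
    (fun m => by cases m <;> rfl) (fun i => htop i a b a b)
    (fun m i => by
      show AF m (i + 1) a b a b + AF m (i + 1) b a a b + (AF m (i + 1) a b b a + AF m (i + 1) b a b a)
        = (BF m i a b a b + BF m i b a a b + (BF m i a b b a + BF m i b a b a))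
          + (AF (m + 1) i a b a b + AF (m + 1) i b a a b + (AF (m + 1) i a b b a + AF (m + 1) i b a b a))
      rw [hdeep m i a b a b, hdeep m i b a a b, hdeep m i a b b a, hdeep m i b a b a]
      ring)
  refine key.trans (forall_congr' fun l => ?_)
  have hS1 : ∀ k ∈ range (l + 1), (Nat.rec (motive := fun _ => ℝ) (B k a b a b + B k b a a b + (B k a b b a + B k b a b a))
        (fun m' _ => BF m' k a b a b + BF m' k b a a b + (BF m' k a b b a + BF m' k b a b a)) (l + 1 - k) : ℝ)
      = BF (l - k) k a b a b + BF (l - k) k b a a b + (BF (l - k) k a b b a + BF (l - k) k b a b a) := by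
    intro k hk
    have hkl : k < l + 1 := Finset.mem_range.mp hk
    rw [show l + 1 - k = l - k + 1 by omega]
  have hS2 : ∀ k ∈ range l, (Nat.rec (motive := fun _ => ℝ) (B k a b a b + B k b a a b + (B k a b b a + B k b a b a))
        (fun m' _ => BF m' k a b a b + BF m' k b a a b + (BF m' k a b b a + BF m' k b a b a)) (l - k) : ℝ)
      = BF (l - 1 - k) k a b a b + BF (l - 1 - k) k b a a b + (BF (l - 1 - k) k a b b a + BF (l - 1 - k) k b a b a) := by
    intro k hk
    have hkl : k < l := Finset.mem_range.mp hk
    rw [show l - k = l - 1 - k + 1 by omega]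
  show (B (l + 1) a b a b + B (l + 1) b a a b + (B (l + 1) a b b a + B (l + 1) b a b a))
          + γ * ((∑ k ∈ range (l + 1), Nat.rec (motive := fun _ => ℝ) (B k a b a b + B k b a a b + (B k a b b a + B k b a b a))
                  (fun m' _ => BF m' k a b a b + BF m' k b a a b + (BF m' k a b b a + BF m' k b a b a)) (l + 1 - k))
            + (AF (l + 1) 0 a b a b + AF (l + 1) 0 b a a b + (AF (l + 1) 0 a b b a + AF (l + 1) 0 b a b a)))
        = u * ((B l a b a b + B l b a a b + (B l a b b a + B l b a b a))
          + γ * ((∑ k ∈ range l, Nat.rec (motive := fun _ => ℝ) (B k a b a b + B k b a a b + (B k a b b a + B k b a b a))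
                  (fun m' _ => BF m' k a b a b + BF m' k b a a b + (BF m' k a b b a + BF m' k b a b a)) (l - k))
            + (AF l 0 a b a b + AF l 0 b a a b + (AF l 0 a b b a + AF l 0 b a b a)))) ↔ _
  rw [Finset.sum_congr rfl hS1, Finset.sum_congr rfl hS2]

end Summit.QuantumFields.BalabanUV.Beta.GAN24.CrossedLedgerUnrolled
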